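import Mathlib
import Summits.Langlands.Langlands.Theses.IrreducibilityBySelfDuality
import Literature.NumberTheory.Automorphic.ClozelAlgebraicity
import Literature.NumberTheory.GaloisRepresentations.HeckeCharacterArchType
import Literature.NumberTheory.NumberFields.ChevalleyUnitCongruence

/-!
# Sketch — crux-ideate stmt-Langlands-14069 (RegularTwistCM), ideator 2, round 1

First-lemma signatures for the two idea cards (elaboration certificate only; `sorry` allowed).

* Card `multiset-purity-parity`: `parity_of_pureAP` (pure combinatorics, provable now) and the
  minimal HC-level vendored fact `AdjointArchShadowHC` the line needs as its only new
  archimedean input, plus the reduction shape `regularTwistCM_of_shadow`.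
* Card `unimodular-normal-form`: `exists_angular_heckeCharacter_of_isCMField` (elementary over a
  CM field: Kronecker + one auxiliary prime + quadratic inert primes) and
  `exists_sq_eq_mul_isFiniteOrder` (the ONE square root the line takes, from Weil's criterion).
-/

open scoped BigOperators
open NumberField

namespace Summit.Langlands.Langlands.Cruxes.RegularTwistCM.SketchIdeator2

open Literature.NumberTheory.Automorphic Literature.NumberTheory.GaloisRepresentations

/-- The Harish-Chandra (multiset) shadow of `Ad` on a rank-2 HC datum `{x, y}` at one embedding:
`{x - y, 0, y - x}` (eigenvalue exponents of `Ad ∘ diag(z^x·, z^y·)` on `𝔰𝔩₂`). -/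
def adHC (x y : ℂ) : Multiset ℂ := {x - y, 0, y - x}

/-- **Card A, first lemma (AP-means).** If the rank-3 HC multiset at `ι` is `p + {a, 0, -a}` and
at `c ∘ ι` is `p' + {b, 0, -b}`, it is integral (C-algebraic for `n = 3`), regular, and PURE ON
MULTISETS (Clozel Lemme 4.9 in the tree's form: multiset at `c∘ι` = `w −` multiset at `ι`), then
`a ∈ ℤ ∖ {0}` and `a + b` is EVEN (indeed `b = ±a`).  No Langlands-parameter pairs, no unitary
dual of `GL₂(ℂ)`. -/
theorem parity_of_pureAP (p a p' b : ℂ) (w : ℤ)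
    (hint : ∀ z ∈ (adHC a 0).map (· + p), ∃ k : ℤ, z = k)
    (hreg : ((adHC a 0).map (· + p)).Nodup)
    (hpure : (adHC b 0).map (· + p') = ((adHC a 0).map (· + p)).map (fun z => (w : ℂ) - z)) :
    (∃ k : ℤ, a = k ∧ k ≠ 0) ∧ p' = w - p ∧ (b = a ∨ b = -a) := by
  -- means of the two arithmetic progressions
  have hsum := congrArg Multiset.sum hpure
  simp only [adHC, Multiset.insert_eq_cons, Multiset.map_cons, Multiset.map_singleton,
    Multiset.sum_cons, Multiset.sum_singleton] at hsum
  have hp' : p' = w - p := by linear_combination hsum / 3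
  -- regularity: a ≠ 0
  have ha0 : a ≠ 0 := by
    intro h
    subst h
    simp [adHC] at hreg
  -- integrality: a ∈ ℤ
  obtain ⟨k₁, hk₁⟩ := hint (a - 0 + p) (by simp [adHC])
  obtain ⟨k₂, hk₂⟩ := hint (0 + p) (by simp [adHC])
  have ha : a = ((k₁ - k₂ : ℤ) : ℂ) := by push_cast; linear_combination hk₁ - hk₂
  refine ⟨⟨k₁ - k₂, ha, ?_⟩, hp', ?_⟩
  · intro hk
    apply ha0
    rw [ha, hk]
    simp
  -- the extreme terms: w - (a + p) lies in the multiset at c∘ι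
  · have hmem : ((w : ℂ) - (a - 0 + p)) ∈ (adHC b 0).map (· + p') := by
      rw [hpure]
      simp [adHC]
    simp only [adHC, Multiset.insert_eq_cons, Multiset.map_cons, Multiset.map_singleton,
      Multiset.mem_cons, Multiset.mem_singleton] at hmem
    rcases hmem with h | h | h
    · right; linear_combination -h - hp'
    · exfalso; apply ha0; linear_combination -h - hp'
    · left; linear_combination h + hp'

/-- **Card A, the minimal vendored archimedean input (HC level, expressible today).**
For cuspidal `π` on `GL₃`, `σ₀` on `GL₂`, `ν` on `GL₁` over ANY number field with
`t_π = d · Ad(t_{σ₀})` a.e. (verbatim the crux's hypothesis), the archimedean (Harish-Chandra)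
parameters — which exist and are unique (`exists_hasInfinityType`, `hasArchParameter_unique`) —
satisfy `HC(π)(ι) = HC(ν)(ι) + Ad(HC(σ₀)(ι))` at every complex embedding `ι`.
Source: Gelbart–Jacquet 1978 Thm (9.3)(2) (local lift at EVERY place) + Jacquet–Shalika 1981 II
Thm 4.4 (rigidity of isobaric representations incl. archimedean components); the dihedral case
is vacuous (cuspidal `π ⊗ ν⁻¹` cannot be nearly equivalent to a non-cuspidal isobaric sum). -/
def AdjointArchShadowHC : Prop :=
  ∀ (K : Type) [Field K] [NumberField K]
    (h1 : isCompact_glFiniteIntegralLevel 1 K) (hcpt₂ : isCompact_glFiniteIntegralLevel 2 K)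
    (hcpt : isCompact_glFiniteIntegralLevel 3 K)
    (π : CuspidalAutomorphicRepData 3 K hcpt) (σ₀ : CuspidalAutomorphicRepData 2 K hcpt₂)
    (ν : CuspidalAutomorphicRepData 1 K h1),
    (∀ᶠ v in Filter.cofinite, ∀ α β : Multiset ℂ, π.1.HasSatakeParamAt v α →
        σ₀.1.HasSatakeParamAt v β → ∃ d : ℂ, ν.1.HasSatakeParamAt v {d} ∧
          α = (((β ×ˢ β).map (fun q : ℂ × ℂ => q.1 * q.2⁻¹)).erase 1).map (fun c => d * c)) →
    ∀ (χπ χσ χν : (K →+* ℂ) → Multiset ℂ),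
      π.1.HasArchParameter χπ → σ₀.1.HasArchParameter χσ → ν.1.HasArchParameter χν →
      ∀ ι : K →+* ℂ, ∃ x y p : ℂ, χσ ι = {x, y} ∧ χν ι = {p} ∧ χπ ι = (adHC x y).map (· + p)

/-- **Card A, reduction shape** (plan-level; what the line owes besides pure bookkeeping):
multiset purity (Clozel's fact), the HC-level adjoint shadow, Weil's unit criterion and
Chevalley's congruence theorem give the crux.  (The archimedean parameter of the twist by an
arbitrary Hecke character — the tree's `ArchParameterTwistNorm` for a general differential — is
the remaining in-tree bookkeeping, not listed as an input.) -/
theorem regularTwistCM_of_shadow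
    (hC : Clozel1990_regularAlgebraic) (hA : AdjointArchShadowHC)
    (hW : Patrikis2019_heckeCharacter_archType_iff_units)
    (hCh : Literature.NumberTheory.NumberFields.Chevalley1951.thm1_units) :
    Summit.Langlands.Langlands.Theses.IrreducibilityBySelfDuality.RegularTwistCM := by
  sorry

/-- **Card C, first lemma (angular characters over a CM field are elementary).** For `K` CM and
ANY integer vector `m` on the (complex) places there is a Hecke character with archimedean part
`∏_w (z_w/|z_w|)^{m_w}`: it kills `(𝓞_K(𝔭₀)ˣ)²` for one prime `𝔭₀ = 𝔭̄₀` (Kronecker: `u/ū` is a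
root of unity, `≡ 1 (𝔭₀)` forces `u = ū`), and `(𝓞_K(𝔭₀)ˣ)² ⊇ 𝓞_K(𝔭₀∏𝔭ᵢ)ˣ` for primes `𝔭ᵢ`
inert in `K(√vᵢ)` (quadratic Chebotarev, in tree) — no Chevalley 1951.  False for non-CM totally
imaginary `K` (Patrikis Lemma 2.1.5), so `IsCMField` is load-bearing exactly here. -/
theorem exists_angular_heckeCharacter_of_isCMField (K : Type) [Field K] [NumberField K]
    (hK : IsCMField K) (m : InfinitePlace K → ℤ) :
    ∃ ψ : HeckeCharacter K, ψ.HasUnitaryArchType m (fun _ => 0) := by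
  sorry

/-- **Card C, the one square root** (from Weil's criterion, any number field): a unitary Hecke
character whose angular exponents are all even is a square up to a finite-order character
(the candidate half-type kills an index-≤2 subgroup of the congruence unit group killed by `ω`). -/
theorem exists_sq_eq_mul_isFiniteOrder (hW : Patrikis2019_heckeCharacter_archType_iff_units)
    (K : Type) [Field K] [NumberField K] (ω : HeckeCharacter K)
    (m : InfinitePlace K → ℤ) (t : InfinitePlace K → ℝ) (hω : ω.HasUnitaryArchType m t)
    (heven : ∀ w, Even (m w)) :
    ∃ ψ ε : HeckeCharacter K, ε.IsFiniteOrder ∧ ψ ^ 2 = ω * ε := by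
  sorry

end Summit.Langlands.Langlands.Cruxes.RegularTwistCM.SketchIdeator2
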